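import Summits.Schanuel.Schanuel.Theses.DiophantineDichotomy
import Literature.NumberTheory.Transcendental.NesterenkoEliminationFacts

/-!
# Sketch — crux-ideate `stmt-Schanuel-6117` (`DiophantineDichotomy.ApproximationProperty`),
# round 1, ideator 2 (`planner-cruxidea-stmt-Schanuel-6117-2-0`)

First lemmas of the three idea cards (they must ELABORATE; nothing here is claimed proved):

* §0  the crux factored pointwise (`APDatum`/`APWith`/`APAt`, copied verbatim from the standing
      disprover's `Cruxes/ApproximationProperty/Disproof.lean` §0 so that lines can be stated
      against the same predicates), `approximationProperty_iff` (by `Iff.rfl`).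
* §A  idea `orbit-interpolation-determinant`: `OrbitClusterBoundDim2` — the `t = 2` case of the
      multivariate Lemma A.8 (Galois-orbit Vandermonde): conjugate clusters of size `k` and radius
      `r` cost `k^{3/2} log(1/r) ≲ d·δ·(log H + …)` when the orbit spans its field in degree `δ`.
* §A′ idea `orbit-interpolation-determinant`, transfer in the tree's Nesterenko language:
      `SharpClosestPoint` (Prop 4.13 of LNM 1752 Ch. 3 with the 1/deg loss removed).
* §B  idea `uniform-relative-restart`: `LiftingStep` (algebraic coordinates ride along) and
      `UniformAPOnLines` (the simplest uniform relative case: explicit dependence on the height of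
      a rational line enters the constant linearly).
* §C  idea `kantorovich-fitting-dichotomy`: `KantorovichExtraction` (Newton–Kantorovich certificate
      for `t` integer polynomials at a point) and `NondegenerateZeroAlgebraic` (Ax-style: a zero
      with invertible Jacobian has algebraic coordinates).
-/

set_option linter.dupNamespace false

namespace Summit.Schanuel.Schanuel.Cruxes.ApproximationProperty.Ideate2

open Summit.Schanuel.Schanuel.Theses.DiophantineDichotomy
open scoped BigOperators

noncomputable section

/-! ## §0 The crux, pointwise (verbatim from Disproof.lean §0) -/

/-- The approximation DATUM of the crux: `γ` approximates `θ` at scale `(Δ, Y)` with certified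
joint degree `d`, naive height `H`, exponent `t`, constant `c`. [Disproof.lean §0] -/
def APDatum {ι : Type} [Fintype ι] (θ : ι → ℂ) (t : ℕ) (c Δ Y : ℝ) (γ : ι → ℂ) (d H : ℕ) :
    Prop :=
  Module.finrank ℚ ↥(IntermediateField.adjoin ℚ (Set.range γ)) ≤ d ∧
  (∀ i, ∃ P : Polynomial ℤ, P ≠ 0 ∧ P.natDegree ≤ d ∧ (∀ k, |P.coeff k| ≤ (H : ℤ)) ∧
    Polynomial.aeval (γ i) P = 0) ∧
  (d : ℝ) ≤ (c * Δ) ^ t ∧ Real.log H ≤ c * Y * Δ ^ (t - 1) ∧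
  ‖γ - θ‖ ≤ Real.exp (-((Real.log H * Δ + d * Y) / c))

/-- AP at `θ`, exponent `t`, with a GIVEN constant `c` (all scales `Y ≥ Δ ≥ c`). -/
def APWith {ι : Type} [Fintype ι] (θ : ι → ℂ) (t : ℕ) (c : ℝ) : Prop :=
  ∀ Δ Y : ℝ, c ≤ Δ → Δ ≤ Y → ∃ (γ : ι → ℂ) (d H : ℕ), APDatum θ t c Δ Y γ d H

/-- AP at `θ` with exponent `t` (some constant `c ≥ 1`). -/
def APAt {ι : Type} [Fintype ι] (θ : ι → ℂ) (t : ℕ) : Prop :=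
  ∃ c : ℝ, 1 ≤ c ∧ APWith θ t c

/-- The crux is verbatim `1 ≤ t → trdeg ℚ(θ) ≤ t → APAt θ t`. -/
theorem approximationProperty_iff :
    ApproximationProperty ↔ ∀ (ι : Type) [Fintype ι] (θ : ι → ℂ) (t : ℕ), 1 ≤ t →
      Algebra.trdeg ℚ ↥(IntermediateField.adjoin ℚ (Set.range θ)) ≤ (t : Cardinal) →
        APAt θ t :=
  Iff.rfl

/-- Naive certificate of algebraicity in the crux's currency: `z` is a root of a non-zero integer
polynomial of degree `≤ D` with coefficients bounded by `H`. -/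
def NaiveCert (z : ℂ) (D H : ℕ) : Prop :=
  ∃ P : Polynomial ℤ, P ≠ 0 ∧ P.natDegree ≤ D ∧ (∀ k, |P.coeff k| ≤ (H : ℤ)) ∧
    Polynomial.aeval z P = 0

/-! ## §A  Orbit interpolation determinant (multivariate Lemma A.8), `t = 2` -/

/-- **Idea A, first lemma (`t = 2`): Galois-orbit Vandermonde = bivariate Lemma A.8.** Let
`K ⊂ ℂ` be a number field of degree `d` generated by `β = (β₁, β₂)`, `βⱼ` a root of the
IRREDUCIBLE integer polynomial `Pⱼ` (so `deg Pⱼ = [ℚ(βⱼ):ℚ]`, `M(βⱼ) ≤ √(deg+1)·H(Pⱼ)`), and assume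
the monomials of total degree `≤ δ` in `β` SPAN `K` over `ℚ` (equivalently: the Galois orbit of
`β` imposes `d` independent conditions on polynomials of degree `≤ δ`; `δ` = interpolation degree
of the orbit). If `k` DISTINCT embeddings `σᵢ : K → ℂ` put `σᵢ(β)` in the sup-ball of radius
`r ≤ 1` about `x ∈ ℂ²`, then
`(k^{3/2}/3 − k)·log(1/r) ≤ C·(δ·Σⱼ (d/deg Pⱼ)(log H(Pⱼ) + log(deg Pⱼ + 1)) + kδ·log(2+‖x‖)
+ d log(d+1) + k log(δ+2))`.
Note `(d/deg Pⱼ)·log H(Pⱼ) ≈ d·h(βⱼ)` is the log-SIZE of the point (the crux's `log H` scale), so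
the right side is `≍ δ·log H_β`: with `δ = O(Δ)` it is a bounded multiple of the `Δ·log H` term
of the crux's exponent. Proof sketch: `V = (σ(mⱼ))_{σ,j}` for a monomial `ℚ`-basis `m₁…m_d` of `K`
has `det V² = discr ∈ ℚ×`; product formula + ultrametric Hadamard give
`log|det V| ≥ −δ Σⱼ d·h(βⱼ)`; the EXACT Taylor expansion of the `k` clustered rows at `x` forces
distinct multi-indices, so `|det V| ≤ N_δ^k · r^{Σ ord} · ∏‖T_a‖ · ∏_{σ ∉ cluster} ‖row_σ‖` with
`Σ ord ≥ k^{3/2}/3 − k` (orders fill as `0,1,1,2,2,2,…`). General `t`: exponent `k^{1+1/t}`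
(`c_t = t(t!)^{1/t}/(t+1)`); `t = 1` is Mahler/Diaz (tree: `norm_sub_root_pow_le`). -/
def OrbitClusterBoundDim2 : Prop :=
  ∃ C : ℝ, 0 < C ∧ ∀ (K : IntermediateField ℚ ℂ) (β : Fin 2 → ↥K) (P : Fin 2 → Polynomial ℤ)
    (Hb : Fin 2 → ℕ) (d δ k : ℕ) (σ : Fin k → (↥K →ₐ[ℚ] ℂ)) (x : Fin 2 → ℂ) (r : ℝ),
    Module.finrank ℚ ↥K = d → 1 ≤ d →
    (∀ j, Irreducible (P j) ∧ Polynomial.aeval ((β j : ↥K) : ℂ) (P j) = 0 ∧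
      ∀ n, |(P j).coeff n| ≤ (Hb j : ℤ)) →
    (∀ z : ↥K, ∃ Q : MvPolynomial (Fin 2) ℚ, Q.totalDegree ≤ δ ∧ MvPolynomial.aeval β Q = z) →
    Function.Injective σ → 0 < r → r ≤ 1 →
    (∀ i, ‖(fun j => σ i (β j)) - x‖ ≤ r) →
    ((k : ℝ) ^ ((3 : ℝ) / 2) / 3 - k) * Real.log (1 / r) ≤
      C * ((δ : ℝ) * ∑ j, ((d : ℝ) / ((P j).natDegree : ℝ)) *
              (Real.log (Hb j) + Real.log (((P j).natDegree : ℝ) + 1))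
        + k * δ * Real.log (2 + ‖x‖) + d * Real.log ((d : ℝ) + 1) + k * Real.log ((δ : ℝ) + 2))

/-! ## §A′  Idea A in the tree's elimination language: a sharp closest-point property

`Literature.NumberTheory.Transcendental.Nesterenko` (LNM 1752 Ch. 3 §4, all PROVED in tree):
`NesterenkoPhilippon2001_ch3_prop_4_13` gives, for an unmixed `I` of rank `r`, a zero `β` with
`deg I · log ‖ω − β‖ ≤ (1/r)(log|I(ω̄)| + h(I)) + 4m³ deg I` — for a 0-dimensional prime (`r = 1`,
a Galois orbit) the VALUE term is divided by `deg 𝔭`: the average over conjugates. Idea A claims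
the division can be replaced by a constant `ℓ − 1` once forms of degree `δ` separate the zeros of
`𝔭` (interpolation degree `δ`), the height term becoming `δ·h(𝔭)/ℓ^{1/m}` (the `k^{1+1/m}` tail).
With `NesterenkoPhilippon2001_ch3_prop_4_7` (PROVED: values, degrees and heights split additively
over primary components WITH exponents) this is the whole 0-cycle → point step. -/

section Native

open Literature.NumberTheory.Transcendental.Nesterenko MvPolynomial

attribute [local instance] MvPolynomial.gradedAlgebra

/-- **Idea A, transfer `C⁺` (all `m`).** Sharp closest-point property for 0-dimensional primes:
for `ℓ ≥ 2` and a homogeneous prime `𝔭 ⊂ ℚ[x₀,…,x_m]` of rank `1` whose zeros impose independent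
conditions on forms of degree `δ` (`H_𝔭(δ) = deg 𝔭`), some zero `β` has
`(ℓ−1)·log(1/‖ω̄ − β̄‖) ≥ log(1/|𝔭(ω̄)|) − C·(δ·h(𝔭)/ℓ^{1/m} + δ·deg 𝔭·(log(2+‖ω̄‖) + log(δ+2))
 + deg 𝔭·(log(deg 𝔭 + 1) + m³))`. -/
def SharpClosestPoint : Prop :=
  ∀ m : ℕ, 1 ≤ m → ∃ C : ℝ, 0 < C ∧ ∀ ℓ : ℕ, 2 ≤ ℓ →
    ∀ (𝔭 : Ideal (Rx m)) (δ : ℕ) (ω : Fin (m + 1) → ℂ), 𝔭.IsPrime →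
      𝔭.IsHomogeneous (homogeneousSubmodule (Fin (m + 1)) ℚ) → IsUnmixedOfRank 𝔭 1 → ω ≠ 0 →
      Module.finrank ℚ ↥(homogeneousSubmodule (Fin (m + 1)) ℚ δ) =
        Module.finrank ℚ ↥(homogeneousSubmodule (Fin (m + 1)) ℚ δ ⊓ 𝔭.restrictScalars ℚ) +
          ideg 𝔭 1 →
      ∃ β ∈ projZeros 𝔭,
        -Real.log (iabs 𝔭 1 ω) -
            C * ((δ : ℝ) * iheight 𝔭 1 / (ℓ : ℝ) ^ (1 / (m : ℝ)) +
              δ * (ideg 𝔭 1 : ℝ) * (Real.log (2 + ‖ω‖) + Real.log ((δ : ℝ) + 2)) +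
              (ideg 𝔭 1 : ℝ) * (Real.log ((ideg 𝔭 1 : ℝ) + 1) + (m : ℝ) ^ 3)) ≤
          ((ℓ : ℝ) - 1) * (-Real.log (projDist ω β))

/-- For comparison, the tree's PROVED average form (Prop. 4.13 at `r = 1`), restated. -/
example (h : NesterenkoPhilippon2001_ch3_prop_4_13) (m : ℕ) (hm : 1 ≤ m) (I : Ideal (Rx m))
    (hI : I.IsHomogeneous (homogeneousSubmodule (Fin (m + 1)) ℚ)) (hU : IsUnmixedOfRank I 1)
    (ω : Fin (m + 1) → ℂ) (hω : ω ≠ 0) :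
    ∃ β ∈ projZeros I, projDist ω β ^ ideg I 1 ≤
      (iabs I 1 ω * Real.exp (iheight I 1)) ^ (1 / ((1 : ℕ) : ℝ)) *
        Real.exp (4 * (m : ℝ) ^ 3 * ideg I 1) :=
  h m 1 I le_rfl hm hI hU ω hω

end Native

/-! ## §B  Uniform relative restart: lifting and the linear case -/

/-- **Idea B, first lemma (lifting step).** Adjoining to `θ` a coordinate `η` algebraic over
`ℚ(θ)` preserves the pointwise approximation property with the same exponent `t ≥ 1` (the
constant may change: it absorbs `deg`/height of the minimal polynomial of `η` over `ℚ(θ)`, a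
Lipschitz constant of the implicit root, and `log⁺‖θ‖` — cf. `approximationProperty_uniform_false`
in Disproof.lean). With `APAt` on algebraically independent tuples this reduces the crux to
points of `ℂᵗ` with independent coordinates. -/
def LiftingStep : Prop :=
  ∀ (ι : Type) [Fintype ι] (θ : ι → ℂ) (η : ℂ) (t : ℕ), 1 ≤ t →
    IsAlgebraic ↥(IntermediateField.adjoin ℚ (Set.range θ)) η →
    APAt θ t → APAt (fun o : Option ι => o.elim η θ) t

/-- **Idea B, second stub (uniformity on rational lines).** The degree-one approximation property
transported along a rational affine line `y = u + v·ξ` of `ℂᴺ` (`u, v ∈ ℤᴺ`, `|uᵢ|, |vᵢ| ≤ B`):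
the constant is multiplied by `C·(1 + log(B+1))` and nothing else — the height of the obstruction
is paid linearly in the constant (hence in the height SCALE), never in the degree scale. -/
def UniformAPOnLines : Prop :=
  ∃ C : ℝ, 1 ≤ C ∧ ∀ (N : ℕ) (u v : Fin N → ℤ) (B : ℕ) (ξ : ℂ) (c₀ : ℝ),
    (∀ i, |u i| ≤ (B : ℤ) ∧ |v i| ≤ (B : ℤ)) → 1 ≤ c₀ → APWith (fun _ : Fin 1 => ξ) 1 c₀ →
    APWith (fun i => (u i : ℂ) + (v i : ℂ) * ξ) 1 (C * c₀ * (1 + Real.log ((B : ℝ) + 1)))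

/-! ## §C  Newton–Kantorovich certificate and algebraicity of non-degenerate zeros -/

/-- **Idea C, first lemma (Kantorovich extraction).** `t` integer polynomials in `t` variables of
degree `≤ Δ` and height `≤ H`, a point `x` with `‖x‖∞ ≤ 1`, values `‖Pᵢ(x)‖ ≤ ε`, Jacobian at
`x` with inverse bounded by `K` (stated as `‖v‖ ≤ K‖J v‖`), and the Kantorovich smallness
`8K²ε(t+1)²(Δ+1)^{t+2}(H+1)2^Δ ≤ 1`: then the system has an honest zero `γ` with INVERTIBLE
Jacobian within `2Kε` of `x`. (Classical Newton–Kantorovich; constants generous.) -/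
def KantorovichExtraction : Prop :=
  ∀ (t : ℕ) (P : Fin t → MvPolynomial (Fin t) ℤ) (x : Fin t → ℂ) (Δ H : ℕ) (ε K : ℝ),
    (∀ i, (P i).totalDegree ≤ Δ) → (∀ i m, |(P i).coeff m| ≤ (H : ℤ)) → ‖x‖ ≤ 1 → 0 ≤ ε →
    (∀ i, ‖MvPolynomial.aeval x (P i)‖ ≤ ε) → 0 < K →
    (∀ v : Fin t → ℂ, ‖v‖ ≤ K *
      ‖(Matrix.of fun i j => MvPolynomial.aeval x (MvPolynomial.pderiv j (P i))).mulVec v‖) →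
    8 * K ^ 2 * ε * ((t : ℝ) + 1) ^ 2 * ((Δ : ℝ) + 1) ^ (t + 2) * ((H : ℝ) + 1) * 2 ^ Δ ≤ 1 →
    ∃ γ : Fin t → ℂ, (∀ i, MvPolynomial.aeval γ (P i) = 0) ∧
      (Matrix.of fun i j => MvPolynomial.aeval γ (MvPolynomial.pderiv j (P i))).det ≠ 0 ∧
      ‖γ - x‖ ≤ 2 * K * ε

/-- **Idea C, second stub (Ax-style algebraicity).** A common zero of `t` integer polynomials in
`t` variables at which the Jacobian is invertible has algebraic coordinates (apply a non-zero
`ℚ`-derivation of `ℚ(γ)` to the equations). So Kantorovich outputs are admissible approximants,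
of degree `≤ ∏ deg Pᵢ` by Bézout. -/
def NondegenerateZeroAlgebraic : Prop :=
  ∀ (t : ℕ) (P : Fin t → MvPolynomial (Fin t) ℤ) (γ : Fin t → ℂ),
    (∀ i, MvPolynomial.aeval γ (P i) = 0) →
    (Matrix.of fun i j => MvPolynomial.aeval γ (MvPolynomial.pderiv j (P i))).det ≠ 0 →
    ∀ j, IsAlgebraic ℤ (γ j)

/-! ## Sanity: the statements are propositions about the crux's own predicates -/

example : ApproximationProperty → ∀ (ι : Type) [Fintype ι] (θ : ι → ℂ),
    Algebra.trdeg ℚ ↥(IntermediateField.adjoin ℚ (Set.range θ)) ≤ (3 : Cardinal) → APAt θ 3 :=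
  fun h ι _ θ hθ => (approximationProperty_iff.mp h) ι θ 3 (by norm_num) (by exact_mod_cast hθ)

end

end Summit.Schanuel.Schanuel.Cruxes.ApproximationProperty.Ideate2
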